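import Mathlib
import HarnessLib
import Summits.Parity.GeneralizedHardyLittlewood.Theses.LiouvilleMAD
import Summits.Parity.GeneralizedHardyLittlewood.Theorems.DilatedChowla.Negative.DilatedChowlaMirrorDefs
import Summits.Parity.GeneralizedHardyLittlewood.Theorems.DilatedChowla.Negative.DilatedChowlaMirrorOnePointDefs
import Summits.Parity.GeneralizedHardyLittlewood.Theorems.DilatedChowla.Negative.DilatedChowlaGram
import Summits.Parity.GeneralizedHardyLittlewood.Theorems.DilatedChowla.Negative.DilatedChowlaMirrorReading
import Summits.Parity.GeneralizedHardyLittlewood.Theorems.DilatedChowla.Negative.DilatedChowlaMirrorMoebiusExc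
import Summits.Parity.GeneralizedHardyLittlewood.Theorems.DilatedChowla.Negative.DilatedChowlaMirrorMoebiusNonexc
import Summits.Parity.GeneralizedHardyLittlewood.Theorems.DilatedChowla.Negative.DilatedChowlaMirrorTransfer
import Summits.Parity.GeneralizedHardyLittlewood.Theorems.DilatedChowla.Negative.DilatedChowlaMirrorOrthogonality
import Summits.Parity.GeneralizedHardyLittlewood.Theorems.DilatedChowla.Negative.DilatedChowlaMirrorBias2

/-!
# `DilatedChowla` (stmt-Parity-13319): the Siegel mirror — the crux implies a real-zero-free
# interval `[1 − 1/(C₀ log² q), 1)` for primitive quadratic Dirichlet `L`-functions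

Assembly of the line `Sketch` (card `siegel-mirror`, crux-ideate r1 ideator 2) for the crux
`Summit.Parity.GeneralizedHardyLittlewood.Theses.LiouvilleMAD.DilatedChowla` (route LiouvilleMAD, rank-4
node): for every `c ≠ 0` there are `κ > 0` and `C` with
`|Σ_{m ∈ (M,2M]} λ(mn+c) λ(mn'+c)| ≤ C · M^{1−κ}` for all `M` and all `1 ≤ n ≠ n' ≤ 2M`.

THEOREM (`siegelMirror`). `DilatedChowla → ∃ C₀ > 0, ¬ SiegelZerosAbove (C₀ · log)`: under the
crux, Siegel zeros (Tao–Teräväinen Definition 1.4, tree `IsSiegelZero`) of quality `η ≥ C₀ log q`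
do not occur at arbitrarily large conductors; equivalently (`siegelMirror_realZeroFree`) there are
`C₀, q₀` with `L(σ, χ) ≠ 0` for every `q ≥ q₀`, every primitive quadratic `χ mod q` and every
`σ ∈ [1 − 1/(C₀ log² q), 1)`.  Unconditionally only Siegel's INEFFECTIVE `1 − β ≥ C(ε) q^{−ε}` is
known; the tree's open rh.S34 (`NoSiegelZeros`, width `c/log q`) implies the conclusion
(`not_siegelZerosAbove_log_of_noSiegelZeros`), so the mirror is a CONSEQUENCE of the crux expected to
be true — it certifies the crux Landau–Siegel-hard (route KILL CRITERION (ii): "does DilatedChowla ⇒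
a zero-free region?" — yes, for real zeros) and does not refute it.

CHAIN (all links landed in `Theorems/DilatedChowla/Negative/`):
1. `moebiusExcLaw` / `moebiusNonexcLaw` — Landau's method with the two poles `s = 1, β`
   (Montgomery–Vaughan §11.3 Ex. 7–8, Thm 11.16; tree `ExcPsiData`, `MoebiusTwist.exists_excPsiData_*`,
   `DirichletZFR.exists_inv_LFunction_bounds`, Landau–Page): for a real `ψ mod k` with an exceptional
   zero `β`, `M(x,ψ) = x^β/(β L'(β,ψ)) + O(x/k⁶)` and `‖M(x,Ξ)‖ ≤ x/k⁶` for every other `Ξ mod k`,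
   once `log x ≥ C₁ (1 + log k)²`;
2. `charTwist_of_moebiusLaws` — transfer to `λ = 𝟙_□ ∗ μ`;
3. `onePointExcLaw_of_charTwistLaw` — orthogonality: `λ` summed over the unit class mod `k` is
   `≈ R y^β/(φ(k)β)`, `R ≥ 1/(C₂ (1 + log k)⁵)`;
4. `coherentBias_one_of_onePointExc` — with a Siegel zero of quality `η ≥ C₀ log q` at `χ mod q`,
   the `V = q` progressions `{qνm + 1 : m ∈ (M, 2M]}`, `M = ⌈exp(C₁(1 + 2 log q)²)⌉`, all have
   `λ`-sums `≥ bM`, `b = 1/(4C₂(1 + 2 log q)⁵)`, `b²V ≥ 4` (undamped because `log(2kM) ≤ η log q`);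
5. `not_dilatedChowla_of_coherentBias` — Gram positivity in the dilation variable + Cauchy–Schwarz.
-/

noncomputable section

namespace Summit.Parity.GeneralizedHardyLittlewood.Theorems.DilatedChowla.Negative

open Summit.Parity.GeneralizedHardyLittlewood.Theses.LiouvilleMAD
open Literature.Barriers.Parity (IsSiegelZero)

/-- The two Möbius laws at common constants. -/
theorem moebiusLaws_holds : MoebiusLaws := by
  obtain ⟨c₁, C₁, C₂, hc₁, hC₁, hC₂, hA⟩ := moebiusExcLaw
  obtain ⟨c₁', C₁', hc₁', hC₁', hB⟩ := moebiusNonexcLaw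
  refine ⟨min c₁ c₁', max C₁ C₁', C₂, lt_min hc₁ hc₁', lt_max_of_lt_left hC₁, hC₂, ?_, ?_⟩
  · exact hA.mono (min_le_left _ _) (le_max_left _ _)
  · exact hB.mono (min_le_right _ _) (le_max_right _ _)

/-- The per-character law for the twisted Liouville sums. -/
theorem charTwist_holds : CharTwist :=
  charTwist_of_moebiusLaws moebiusLaws_holds

/-- The unit-class law: `λ` over `u ≡ 1 (mod k)` under an exceptional zero of a real character mod `k`. -/
theorem onePointExc_holds : OnePointExc :=
  onePointExc_of_charTwist' charTwist_holds

/-- **Siegel class bias.** There is `C₀ > 0` such that Siegel zeros of quality `η ≥ C₀ log q` at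
arbitrarily large conductors force a coherent class bias at shift `1`. -/
theorem coherentBias_one_of_siegelZerosAbove :
    ∃ C₀ : ℝ, 0 < C₀ ∧ (SiegelZerosAbove (fun q => C₀ * Real.log q) → CoherentBias 1) :=
  coherentBias_one_of_onePointExc onePointExc_holds

/-- **The Siegel mirror.** The crux implies that Siegel zeros of quality `≥ C₀ log q` do not occur
at arbitrarily large conductors. -/
theorem siegelMirror (h : DilatedChowla) :
    ∃ C₀ : ℝ, 0 < C₀ ∧ ¬ SiegelZerosAbove (fun q => C₀ * Real.log q) := by
  obtain ⟨C₀, hC₀, himp⟩ := coherentBias_one_of_siegelZerosAbove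
  exact ⟨C₀, hC₀, fun hz => not_dilatedChowla_of_coherentBias one_ne_zero (himp hz) h⟩

/-- The mirror in `_false_of_` form (for the disprover's index): Siegel zeros of every logarithmic
quality at arbitrarily large conductors refute the crux. -/
theorem DilatedChowla_false_of_siegelZerosAbove
    (hz : ∀ C₀ : ℝ, 0 < C₀ → SiegelZerosAbove (fun q => C₀ * Real.log q)) : ¬ DilatedChowla :=
  fun h => by
    obtain ⟨C₀, hC₀, hno⟩ := siegelMirror h
    exact hno (hz C₀ hC₀)

/-- The mirror on the tree's predicate: under the crux every Siegel zero at a large conductor has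
quality `< C₀ log q`. -/
theorem siegelMirror_quality (h : DilatedChowla) :
    ∃ C₀ : ℝ, 0 < C₀ ∧ ∃ q₀ : ℕ, ∀ (q : ℕ) [NeZero q] (χ : DirichletCharacter ℂ q) (η : ℝ),
      q₀ ≤ q → IsSiegelZero χ η → η < C₀ * Real.log q := by
  obtain ⟨C₀, hC₀, hno⟩ := siegelMirror h
  refine ⟨C₀, hC₀, ?_⟩
  by_contra hcon
  push Not at hcon
  apply hno
  intro q₀
  obtain ⟨q, hq, χ, η, hq₀, hz, hη⟩ := hcon q₀
  exact ⟨q, hq, χ, η, hq₀, hη, hz⟩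

/-- **The mirror as a zero-free interval.** Under the crux there are `C₀ > 0` and `q₀` such that
`L(σ, χ) ≠ 0` for every conductor `q ≥ q₀`, every primitive quadratic `χ mod q` and every real
`σ ∈ [1 − 1/(C₀ log² q), 1)`. -/
theorem siegelMirror_realZeroFree (h : DilatedChowla) :
    ∃ C₀ : ℝ, 0 < C₀ ∧ ∃ q₀ : ℕ, ∀ (q : ℕ) [NeZero q] (χ : DirichletCharacter ℂ q),
      χ.IsPrimitive → χ.IsQuadratic → q₀ ≤ q →
        ∀ σ : ℝ, 1 - 1 / (C₀ * Real.log q ^ 2) ≤ σ → σ < 1 → χ.LFunction (σ : ℂ) ≠ 0 := by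
  obtain ⟨C₀, hC₀, hno⟩ := siegelMirror h
  exact ⟨C₀, hC₀, realZeroFree_of_not_siegelZerosAbove hC₀ hno⟩

end Summit.Parity.GeneralizedHardyLittlewood.Theorems.DilatedChowla.Negative

end
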